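import Summits.QuantumFields.YangMills.Theorems.SwapVirialDeficitBlowUpGnomonicIsotropyDefs
import HarnessLib

/-!
# Route `SwapVirialDeficit` (YangMills): THE FIXED-FRAME ("CARTESIAN-HUB") CHART DEFICIT `F̂cart(a, ε, η)` — the hub link is `a∕‖a‖` itself, not its standard-position
# representative `radialUnit (axisPoint a)` (DEFINITIONS; brick P1b of w2 g60's memo2 = plan of record for `stub_core_tip` of skeleton ➎, LEAD-approved 2026-08-31T22:48Z;
# free-hands support of ⟨stmt-QuantumFields-24197⟩ `SwapVirialDeficit.SwapGluedStiffness`)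

The chart of the route puts the hub's axis at `i`: `leaderTuple a w = (Q x, Q(slaveP A x·z), Q y, Q A)` with `A = radialUnit (axisPoint a)`, `axisPoint a = ⟨re a, ‖im a‖, 0, 0⟩`
— the polar map, singular on the real axis `im a = 0` (the apex of the tip).  The fixed-frame tuple uses `radialUnit a = a∕‖a‖` instead:
* §1 `leaderTupleCart a w := (Q x, Q(slaveP (radialUnit a) x·z), Q y, Q (radialUnit a))`, `cartPoint a ε η` (with the followers), `gnoDeficitCart z χ a ε η := chartDeficit (cartPoint a ε η)`;
* §2 ★★ `gnoDeficitCart_gnoRot` — COVARIANCE: for a unit `u` with `star u * radialUnit (axisPoint a) * u = radialUnit a`, `F̂cart_{a,ε}(gnoRot u η) = F̂_{a,ε}(η)` (central `χ`):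
  the fixed-frame deficit is the chart deficit with all letters rotated into the hub's frame (✓`gnoLetter_rot3`, ✓`radialUnit_conj`, ✓`chartDeficit_conj`);
  `gnoDeficitCart_nonneg`.
So `F̂cart` is a polynomial-type function of `(a∕‖a‖, letters)`, smooth across the real axis, and its fibre integrals equal those of `F̂` (the fibre measure is `gnoRot`-invariant) —
the integrand for ✓`lintegral_coneMeasure_hubCart` in the two-sided fibred Laplace step across the apex (memo2 P2–P8).

HONEST LABEL: definitions and algebra; `stub_core_tip` and the other stubs, ⟨24197⟩ ∕ ⟨24194⟩ OPEN; own crux ⟨22884⟩ `LargeFieldMassRefinementTail` OPEN (blocked-on ⟨19935⟩);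
the Yang–Mills mass gap is NOT proved; no summit is proved by a line.  Three `def`s, theorems otherwise, 0 `sorry`, standard axioms; the route's local `ℍ` measurability
instances (inherited context of ✓`…IsotropyDefs`).  Width seat ym-line-sfw-p2-w2 g60 (cell ym-idea-1, free hands), `--supports stmt-QuantumFields-24197`.
References: [cite: tHooft1979]; [folklore].
-/

set_option autoImplicit false

noncomputable section

open Quaternion Set
open scoped Quaternion
open Literature.MathematicalPhysics.QuantumLattice
open Literature.MathematicalPhysics.QuantumFieldTheory hiding SU2

namespace Summit.QuantumFields.YangMills.Theorems.SwapVirialDeficit.BlowUpRing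

open Summit.QuantumFields.YangMills.Theorems.FemtoTransferGap
open Summit.QuantumFields.YangMills.Theorems.FemtoTransferGap.TT
open Summit.QuantumFields.YangMills.Theorems.VirialFluxGap.RingDeficit
open Summit.QuantumFields.YangMills.Theorems.SwapVirialDeficit.SwapRing
open Literature.Analysis.Calculus (radialUnit radialUnit_def norm_radialUnit)
open Summit.QuantumFields.YangMills.Theorems.SwapTwistDeficit.ToronLog (axisPoint)
open Summit.QuantumFields.YangMills.Theorems.SwapVirialDeficit.ZeroModeSigma (slaveP slaveP_def radialUnit_conj dil3 dilateIm)
open Summit.QuantumFields.YangMills.Theorems.SwapVirialDeficit.BlowUp (leaderTuple leaderTuple_apply quatToSU2_conj_unit dilateIm_one_apply dil3_one')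

variable {L : ℕ} [NeZero L]

/-! ## §1 The fixed-frame tuple and deficit -/

/-- THE FIXED-FRAME LEADER TUPLE at hub `a` and letters `w = ((x, y), z)`: `(Q x, Q(slaveP (a∕‖a‖) x · z), Q y, Q (a∕‖a‖))` — ✓`leaderTuple` with the hub link `a∕‖a‖` itself
in place of its standard-position representative `radialUnit (axisPoint a)`. [folklore] -/
def leaderTupleCart (a : ℍ) (w : (ℍ × ℍ) × ℍ) : Fin 4 → SU2 :=
  ![quatToSU2 w.1.1, quatToSU2 (slaveP (radialUnit a) w.1.1 * w.2), quatToSU2 w.1.2, quatToSU2 (radialUnit a)]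

/-- THE FIXED-FRAME CHART POINT `(leaders, followers)` of hub `a`, signs `ε`, gnomonic letters `η` (no blow-up parameter: `t = 1`). [folklore] -/
def cartPoint (a : ℍ) (ε : GnoSign L) (η : GnoCoord L) : (Fin 4 → SU2) × (Fol L → SU2) :=
  (leaderTupleCart a ((gnoLetter ε.1.1 η.1.1, gnoLetter ε.1.2 η.1.2), gnoLetter ε.2.1 η.2.1), fun f => quatToSU2 (gnoLetter (ε.2.2 f) (η.2.2 f)))

/-- THE FIXED-FRAME ("CARTESIAN-HUB") DEFICIT `F̂cart_{z,a,ε}(η) := chartDeficit (cartPoint a ε η)`. [folklore] -/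
def gnoDeficitCart (z : Fin 3 → Bool) (χ : Site 3 L → SU2) (a : ℍ) (ε : GnoSign L) (η : GnoCoord L) : ℝ :=
  chartDeficit L z χ (cartPoint a ε η)

/-- Components of `leaderTupleCart`. [folklore] -/
theorem leaderTupleCart_apply (a : ℍ) (w : (ℍ × ℍ) × ℍ) :
    leaderTupleCart a w 0 = quatToSU2 w.1.1 ∧ leaderTupleCart a w 1 = quatToSU2 (slaveP (radialUnit a) w.1.1 * w.2) ∧
      leaderTupleCart a w 2 = quatToSU2 w.1.2 ∧ leaderTupleCart a w 3 = quatToSU2 (radialUnit a) :=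
  ⟨rfl, rfl, rfl, rfl⟩

/-- `F̂cart ≥ 0`. [folklore] -/
theorem gnoDeficitCart_nonneg (z : Fin 3 → Bool) (χ : Site 3 L → SU2) (a : ℍ) (ε : GnoSign L) (η : GnoCoord L) : 0 ≤ gnoDeficitCart z χ a ε η :=
  chartDeficit_nonneg z χ _

/-! ## §2 Covariance: the fixed-frame deficit is the chart deficit in the hub's frame -/

omit [NeZero L] in
/-- The chart point at `t = 1` in the letters: `blowUpPoint 1 (gnomonicPoint a ε η) = (leaderTuple a (letters), Q ∘ letters)` (cf. ✓`blowUpPoint_one_gnomonicPoint`). [folklore] -/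
theorem blowUpPoint_one_gnomonicPoint_letters (a : ℍ) (ε : GnoSign L) (η : GnoCoord L) :
    blowUpPoint (L := L) 1 (gnomonicPoint a ε η) =
      (leaderTuple a ((gnoLetter ε.1.1 η.1.1, gnoLetter ε.1.2 η.1.2), gnoLetter ε.2.1 η.2.1), fun f => quatToSU2 (gnoLetter (ε.2.2 f) (η.2.2 f))) := by
  refine Prod.ext ?_ (funext fun i => ?_)
  · show leaderTuple a (dil3 1 (gnomonicPoint a ε η).2.1) = _
    rw [dil3_one']; rfl
  · show quatToSU2 (dilateIm 1 ((gnomonicPoint a ε η).2.2 i)) = _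
    rw [dilateIm_one_apply]; rfl

/-- ★★ **COVARIANCE**: for `a ≠ 0`, a unit quaternion `u` carrying the standard-position hub unit to the hub unit, `star u * radialUnit (axisPoint a) * u = radialUnit a`,
and a central background `χ`: `F̂cart_{a,ε}(gnoRot u η) = F̂_{a,ε}(η)` — rotating all gnomonic letters by `u` turns the chart point into the `(Q u)⁻¹`-conjugate of the
fixed-frame point (✓`gnoLetter_rot3`, ✓`radialUnit_conj`, ✓`quatToSU2_conj_unit`), and the chart deficit is conjugation invariant (✓`chartDeficit_conj`). [cite: tHooft1979] -/
theorem gnoDeficitCart_gnoRot (z : Fin 3 → Bool) {χ : Site 3 L → SU2} (hχ : ∀ (x : Site 3 L) (k : SU2), k * χ x = χ x * k) {a : ℍ} (ha : a ≠ 0)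
    {u : ℍ} (hu : ‖u‖ = 1) (hua : star u * radialUnit (axisPoint a) * u = radialUnit a) (ε : GnoSign L) (η : GnoCoord L) :
    gnoDeficitCart z χ a ε (gnoRot u η) = gnoDeficit z χ a ε η := by
  obtain ⟨huu, huu'⟩ := star_mul_self_of_unit hu
  have hap : axisPoint a ≠ 0 := fun h => by
    apply ha
    have hre : a.re = 0 := by simpa [axisPoint] using congrArg (fun q : ℍ => q.re) h
    have hni : ‖a.im‖ = 0 := by simpa [axisPoint] using congrArg (fun q : ℍ => q.imI) h
    have him : a.im = 0 := norm_eq_zero.1 hni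
    have hI : a.imI = 0 := by simpa using congrArg (fun q : ℍ => q.imI) him
    have hJ : a.imJ = 0 := by simpa using congrArg (fun q : ℍ => q.imJ) him
    have hK : a.imK = 0 := by simpa using congrArg (fun q : ℍ => q.imK) him
    ext <;> simp [hre, hI, hJ, hK]
  have hA0 : radialUnit (axisPoint a) ≠ 0 := radialUnit_ne_zero' hap
  -- the fixed-frame point of the rotated letters is the conjugate of the chart point
  have hpt : cartPoint a ε (gnoRot u η) =
      ((fun m => (quatToSU2 u)⁻¹ * (blowUpPoint (L := L) 1 (gnomonicPoint a ε η)).1 m * ((quatToSU2 u)⁻¹)⁻¹),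
        (fun i => (quatToSU2 u)⁻¹ * (blowUpPoint (L := L) 1 (gnomonicPoint a ε η)).2 i * ((quatToSU2 u)⁻¹)⁻¹)) := by
    rw [inv_inv, blowUpPoint_one_gnomonicPoint_letters]
    unfold cartPoint
    refine Prod.ext ?_ ?_
    · funext m
      fin_cases m
      · show leaderTupleCart a ((gnoLetter ε.1.1 (gnoRot u η).1.1, gnoLetter ε.1.2 (gnoRot u η).1.2), gnoLetter ε.2.1 (gnoRot u η).2.1) 0 = (quatToSU2 u)⁻¹ * leaderTuple a ((gnoLetter ε.1.1 η.1.1, gnoLetter ε.1.2 η.1.2), gnoLetter ε.2.1 η.2.1) 0 * quatToSU2 u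
        rw [(leaderTupleCart_apply a _).1, (leaderTuple_apply a _).1]
        simp only [gnoRot]
        rw [gnoLetter_rot3 hu, quatToSU2_conj_unit hu (gnoLetter_ne_zero _ _)]
      · show leaderTupleCart a ((gnoLetter ε.1.1 (gnoRot u η).1.1, gnoLetter ε.1.2 (gnoRot u η).1.2), gnoLetter ε.2.1 (gnoRot u η).2.1) 1 = (quatToSU2 u)⁻¹ * leaderTuple a ((gnoLetter ε.1.1 η.1.1, gnoLetter ε.1.2 η.1.2), gnoLetter ε.2.1 η.2.1) 1 * quatToSU2 u
        rw [(leaderTupleCart_apply a _).2.1, (leaderTuple_apply a _).2.1]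
        simp only [gnoRot]
        rw [slaveP_def, slaveP_def, ← hua, gnoLetter_rot3 hu, gnoLetter_rot3 hu, radialUnit_conj hu,
          ← quatToSU2_conj_unit hu (mul_ne_zero (mul_ne_zero (mul_ne_zero (star_ne_zero.2 hA0) (radialUnit_ne_zero' (gnoLetter_ne_zero _ _))) hA0)
            (gnoLetter_ne_zero _ _))]
        congr 1
        simp only [star_mul, star_star, mul_assoc]
        rw [← mul_assoc u (star u), huu', one_mul, ← mul_assoc u (star u), huu', one_mul, ← mul_assoc u (star u), huu', one_mul]
      · show leaderTupleCart a ((gnoLetter ε.1.1 (gnoRot u η).1.1, gnoLetter ε.1.2 (gnoRot u η).1.2), gnoLetter ε.2.1 (gnoRot u η).2.1) 2 = (quatToSU2 u)⁻¹ * leaderTuple a ((gnoLetter ε.1.1 η.1.1, gnoLetter ε.1.2 η.1.2), gnoLetter ε.2.1 η.2.1) 2 * quatToSU2 u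
        rw [(leaderTupleCart_apply a _).2.2.1, (leaderTuple_apply a _).2.2.1]
        simp only [gnoRot]
        rw [gnoLetter_rot3 hu, quatToSU2_conj_unit hu (gnoLetter_ne_zero _ _)]
      · show leaderTupleCart a ((gnoLetter ε.1.1 (gnoRot u η).1.1, gnoLetter ε.1.2 (gnoRot u η).1.2), gnoLetter ε.2.1 (gnoRot u η).2.1) 3 = (quatToSU2 u)⁻¹ * leaderTuple a ((gnoLetter ε.1.1 η.1.1, gnoLetter ε.1.2 η.1.2), gnoLetter ε.2.1 η.2.1) 3 * quatToSU2 u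
        rw [(leaderTupleCart_apply a _).2.2.2, (leaderTuple_apply a _).2.2.2, ← hua, quatToSU2_conj_unit hu hA0]
    · funext i
      show quatToSU2 (gnoLetter (ε.2.2 i) ((gnoRot u η).2.2 i)) = (quatToSU2 u)⁻¹ * quatToSU2 (gnoLetter (ε.2.2 i) (η.2.2 i)) * quatToSU2 u
      simp only [gnoRot]
      rw [gnoLetter_rot3 hu, quatToSU2_conj_unit hu (gnoLetter_ne_zero _ _)]
  unfold gnoDeficitCart gnoDeficit
  rw [hpt]
  exact chartDeficit_conj z hχ _ _

/-- ★ The same for the trivial background `χ ≡ 1` (skeleton ➎). [cite: tHooft1979] -/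
theorem gnoDeficitCart_gnoRot_one (z : Fin 3 → Bool) {a : ℍ} (ha : a ≠ 0) {u : ℍ} (hu : ‖u‖ = 1)
    (hua : star u * radialUnit (axisPoint a) * u = radialUnit a) (ε : GnoSign L) (η : GnoCoord L) :
    gnoDeficitCart z (fun _ => (1 : SU2)) a ε (gnoRot u η) = gnoDeficit z (fun _ => (1 : SU2)) a ε η :=
  gnoDeficitCart_gnoRot z (fun _ k => by rw [mul_one, one_mul]) ha hu hua ε η

end Summit.QuantumFields.YangMills.Theorems.SwapVirialDeficit.BlowUpRing

end
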